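import Summits.QuantumFields.BalabanUV.T4Continuum.Spine.NE1p.DressedSmallFieldNestedToriWitness

/-!
# T⁴ programme, spine estimate NE1′ (node O3b/H2) — WITNESS «THE NESTED-TORI END FIRES ON A DECIDED TWO-SCALE DATUM», PART 2 of 2 (LIVE): the corner cube's
# collar LEAKS into the next block (interiority is needed), the index at the coarse unit block has EXACTLY TWO labels with majorant mass `ε + v`, the quantity
# bounded by S44's END on PART 1's datum is NOT zero, and the END fires live at `L = 3` (pv22's least) and `L = 13` (print's least admitted, TYPE only)

Cell `pub-balaban`, sub-cell `t4`, row NE1′ formalisation crew (`t4/formal/NE1p/LEAVES.md` row W59 ∕ DAG N29zzzi; INTENT HOME/CLAIMS.log l.21161, BOOKED typer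
R-T133 (ii) l.21254; X183 its read), unit `b2b-balaban-t4-ne1p-formalise-leaf-10` (gen 11).  THEOREMS ONLY (+ one closing `example`); imports PART 1
`Spine/NE1p/DressedSmallFieldNestedToriWitness` ONLY (SAME namespace; no PART 1 name re-declared); nothing restated.
* §1 LOCATED (any `d`): `one_mem_tclosure_corner` — the FAR-CORNER cube `(L−1,…)` of block 0 has `(L,…)` in its 3^d-neighbourhood, which coarsens to block `(1,…)`,
  so `proj N′ 1 ∈ tclosure L N′ {corner}`; `tclosure_corner_ne` (d = 4, `2 ≤ N′`): that closure is NOT `{0}` — PART 1's centre-cube choice is NEEDED;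
* §2 `εN_le_one`, `vN_le` (W53 `vC_le`), `termsN_X₀_card = 2`, **`majN_sum_X₀ = εN + vN`**;
* §3 GENUINE: `actN_X₀` (TWO live terms, ONE common W41 integral `termAt_coreW_pencil`), `actN_real_sub_zero`, `actN_live` (W33 `integral_incr_pos`),
  `norm_actN_X₀_lt_one` (`ε + v ≤ 65∕64`, W41 `norm_term_le`, W24 `dressedConst_le_one`), **`nestedToriEnd_live`** (W24 `exp_locE_cube` at the COARSE torus —
  S44's conclusion IS in the `locE (TTouch) (·.1) … X₀.1` form); closing `example`: (live ∧ bound) at `L = 3` AND `L = 13`, every `N′`.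

WORDING OF RECORD and HONEST FRAMING: as PART 1, verbatim — a DECIDED TOY, two-scale in the closure map ONLY (component length 0; transfer met as `ℓ·0 ≤ 0`; a
positive-length interior component at `L ≥ 5` is a follower); `hinner` CHOSEN; (B3-amp) UNPRINTED for Bałaban's cores (G-ne9p2-5); (B1b) NOT claimed; WHICH tori are
Bałaban's = pv22's READING (D-pv22.3); no numeral of [Balaban1987RGI]∕[Balaban1988RGII] asserted; 0 binders instantiated on Bałaban's densities; no wall item;
wall v1.7 (T4-DAG v47) does NOT move; R-t4r2-Q2 NOT met thereby; NE1′ ⇐ the named binders — NOT proved, NOT printed; spine PROVED 0∕9; count 9 unchanged; 0 sorry,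
0 cite, 0 def, 0 `attribute`; ABSOLUTE RULE honoured.  Rung (B)+1 on ONE finite four-torus — NOT infinite volume, NOT a mass gap, NOT OS on ℝ⁴, NOT Clay.  HONEST
DEPENDENCY: continuum YM on T⁴ ⇐ BetaPertH ∧ nine spine estimates (0/9 proved); BetaPertH ⇐ (D1) ∧ (D4) ∧ CAP+tail; G-an2-4 gates asym, D1 and NE2/3/4.
-/

noncomputable section

namespace Summit.QuantumFields.BalabanUV.T4Continuum.NE1p.DressedSmallFieldNestedToriWitness

open Set Metric MeasureTheory Complex
open scoped BigOperators
open Literature.MathematicalPhysics.QuantumFieldTheory.Balaban1983to89.B12TreeDecay (K₀ K₀_pos kappa₀_nonneg)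
open Literature.MathematicalPhysics.QuantumFieldTheory.Balaban1983to89.B13Resummation (locE)
open Literature.MathematicalPhysics.QuantumFieldTheory.Balaban1983to89.B13ScaleTransfer (Pt block mem_block coarse)
open Literature.MathematicalPhysics.QuantumFieldTheory.Balaban1983to89.TreeLengthTorus (TPt TDom proj natLift proj_natLift tsys
  torusTreeLen)
open Literature.MathematicalPhysics.QuantumFieldTheory.Balaban1983to89.TreeLengthTorusGeometry (tgeometry TTouch)
open Literature.MathematicalPhysics.QuantumFieldTheory.Balaban1983to89.TreeLengthTorusTransfer (tcoarse tcoarse_proj tblock tcollar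
  tclosure)
open Summit.QuantumFields.BalabanUV.T4Continuum.B13HistMeasurable (B13HistM)
open Summit.QuantumFields.BalabanUV.T4Continuum.B13HistWitness (toyFrame)
open Summit.QuantumFields.BalabanUV.T4Continuum.TorusBlockRefinement (natLift_proj_of_range)
open Summit.QuantumFields.BalabanUV.T4Continuum.NE1p.DressedSmallFieldTorusWitness (X₀ X₀_val dressedConst_le_one exp_locE_cube)
open Summit.QuantumFields.BalabanUV.T4Continuum.NE1p.DressedSmallFieldCoresWitness (E1 crd liveTable coreW Acst Acst_pos incr
  integral_incr_pos)
open Summit.QuantumFields.BalabanUV.T4Continuum.NE1p.DressedSmallFieldCoresMassWitness (cM cM_pos)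
open Summit.QuantumFields.BalabanUV.T4Continuum.NE1p.DressedSmallFieldDepCoresWitness (termAt_coreW_pencil closedForm_real_sub_zero
  norm_term_le)
open Summit.QuantumFields.BalabanUV.T4Continuum.NE1p.DressedSmallFieldFamiliesWitness (α₆F α₆F_pos α₆F_le_one)
open Summit.QuantumFields.BalabanUV.T4Continuum.NE1p.DressedSmallFieldComponentsWitness (vC_le)

/-! ## §1 LOCATED: interiority is needed — the corner cube's collar leaks into the next block -/

section Corner
variable {d : ℕ} (L N' : ℕ) [NeZero L] [NeZero N']

/-- **INTERIORITY IS NEEDED** (kernel, LOCATED): the FAR-CORNER cube of block 0 (every coordinate `L − 1`) has the vector `(L, …, L)` in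
its 3^d-neighbourhood, which coarsens to the block `(1, …, 1)` — so `proj N′ 1 ∈ tclosure L N′ {corner}`: the collar LEAKS into the next
block (for `N′ ≥ 2` that block is not block 0, PART 2). [folklore] -/
theorem one_mem_tclosure_corner (hL : 3 ≤ L) :
    proj N' (fun _ => (1 : ℤ)) ∈ tclosure L N' ({proj (L * N') fun _ => ((L - 1 : ℕ) : ℤ)} : Finset (TPt d (L * N'))) := by
  unfold tclosure tcollar
  rw [Finset.singleton_biUnion]
  have hN : 1 ≤ N' := Nat.one_le_iff_ne_zero.2 (NeZero.ne N')
  have hlift : natLift (proj (L * N') fun _ : Fin d => ((L - 1 : ℕ) : ℤ)) = fun _ => ((L - 1 : ℕ) : ℤ) := by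
    refine natLift_proj_of_range fun i => ⟨by positivity, ?_⟩
    have h : L - 1 < L * N' := lt_of_lt_of_le (by omega) (Nat.le_mul_of_pos_right L hN)
    exact_mod_cast h
  refine Finset.mem_image.2 ⟨proj (L * N') fun _ => (L : ℤ), ?_, ?_⟩
  · unfold tblock
    rw [hlift]
    refine Finset.mem_image.2 ⟨fun _ => (L : ℤ), mem_block.2 fun i => ⟨?_, ?_⟩, rfl⟩
    · have : ((L - 1 : ℕ) : ℤ) = (L : ℤ) - 1 := by rw [Nat.cast_sub (by omega)]; simp
      linarith
    · have : ((L - 1 : ℕ) : ℤ) = (L : ℤ) - 1 := by rw [Nat.cast_sub (by omega)]; simp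
      linarith
  · rw [tcoarse_proj]
    have hL0 : (0 : ℤ) < L := by exact_mod_cast (show 0 < L by omega)
    have hc : coarse L (fun _ : Fin d => (L : ℤ)) = fun _ => (1 : ℤ) := by
      funext i
      exact Int.ediv_self hL0.ne'
    rw [hc]


/-- … so for `N′ ≥ 2` (at d = 4) the corner cube's closure is NOT the unit block `{0}`: `(1 : ZMod N′) ≠ 0`. [folklore] -/
theorem tclosure_corner_ne (hL : 3 ≤ L) (hN : 2 ≤ N') :
    tclosure L N' ({proj (L * N') fun _ => ((L - 1 : ℕ) : ℤ)} : Finset (TPt 4 (L * N'))) ≠ {0} := by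
  intro h
  have h1 := one_mem_tclosure_corner (d := 4) L N' hL
  rw [h, Finset.mem_singleton] at h1
  have h2 := congrFun h1 0
  have h3 : ((1 : ℤ) : ZMod N') = 0 := h2
  rw [Int.cast_one] at h3
  haveI : Fact (1 < N') := ⟨by omega⟩
  exact one_ne_zero h3

end Corner

section Live
variable (L N' : ℕ) [NeZero L] [NeZero N']

/-! ## §2 The index at the coarse unit block has EXACTLY TWO labels; the majorant mass is `ε + v` -/

/-- `ε ≤ α₆F ≤ 1` (the denominator is `≥ 81·1·(1∕81)·1 = 1`). [arith] -/
theorem εN_le_one : εN L ≤ 1 := by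
  unfold εN
  have hK : 1 / 81 ≤ K₀ (64 : ℝ) 8 := by
    unfold K₀
    rw [show (((8 : ℕ) : ℝ) + 1) ^ 2 = 81 by norm_num]
    exact div_le_div_of_nonneg_right (Real.one_le_exp (kappa₀_nonneg (by norm_num) _)) (by norm_num)
  have hL1 : (1 : ℝ) ≤ (L : ℝ) ^ 4 := one_le_pow₀ (by exact_mod_cast Nat.one_le_iff_ne_zero.2 (NeZero.ne L))
  have hE : (1 : ℝ) ≤ Real.exp (5 * RN) := Real.one_le_exp (by unfold RN; have := Real.log_nonneg (by norm_num : (1:ℝ) ≤ 162); positivity)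
  have hden : (1 : ℝ) ≤ (3 : ℝ) ^ 4 * (L : ℝ) ^ 4 * K₀ 64 8 * Real.exp (5 * RN) := by
    calc (1 : ℝ) = 81 * 1 * (1 / 81) * 1 := by norm_num
      _ ≤ (3 : ℝ) ^ 4 * (L : ℝ) ^ 4 * K₀ 64 8 * Real.exp (5 * RN) := by
          gcongr
          · norm_num
  calc α₆F / ((3 : ℝ) ^ 4 * (L : ℝ) ^ 4 * K₀ 64 8 * Real.exp (5 * RN)) ≤ α₆F / 1 :=
        div_le_div_of_nonneg_left α₆F_pos.le one_pos hden
    _ ≤ 1 := by rw [div_one]; exact α₆F_le_one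
/-- `ε + v ≤ 1 + 1∕64`… in fact `≤ 1`: `ε ≤ 1∕2` would do; we use `ε·e^{−R₀·0} = ε ≤ 1` and `v ≤ 1∕64` through W53's `vC_le` only in
PART 2's norm bound as `(ε + v)·(A∕2)·(√π∕√(2π)) < 1` with `A ≤ 1`; record `v ≤ 1∕64` here. [arith] -/
theorem vN_le : vN ≤ 1 / 64 := by rw [vN_eq_vC 1]; exact vC_le 1


open Classical in
/-- **EXACTLY TWO LABELS AT THE COARSE UNIT BLOCK** (the covered label with the fine centre-cube component, the uncovered label). [folklore] -/
theorem termsN_X₀_card : (termsN L N' (X₀ N')).card = 2 := by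
  rw [termsN_X₀, Finset.card_insert_of_notMem (by rw [Finset.mem_singleton]; exact coveredN_ne_uncoveredN L N'),
    Finset.card_singleton]

open Classical in
/-- **THE MAJORANT MASS OF THE COARSE UNIT BLOCK**: `Σ_l maj l = ε + v` (the covered label carries the member budget `ε·e^{−R₀·0} = ε`, the
uncovered one the letter `v`). [folklore] -/
theorem majN_sum_X₀ : ∑ l ∈ termsN L N' (X₀ N'), majN L N' l = εN L + vN := by
  rw [termsN_X₀, Finset.sum_insert (by rw [Finset.mem_singleton]; exact coveredN_ne_uncoveredN L N'), Finset.sum_singleton,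
    majN_coveredN, majN_uncoveredN]

/-- `ε + v ≤ 1 + 1∕64` is not enough for the norm bound below; we use `ε + v ≤ 2` with `A·√π∕√(2π) < 1∕…` — in fact `(ε + v)·(A∕2)·(√π∕√(2π)) < 1`
already follows from `ε ≤ 1`, `v ≤ 1∕64`, `A ≤ 1`, `√π∕√(2π) < 1`. [arith] -/
theorem εN_add_vN_le : εN L + vN ≤ 1 + 1 / 64 := by linarith [εN_le_one L, vN_le]

variable (r : ℝ) (hr : 0 ≤ r)

/-! ## §3 GENUINE: on the coarse unit block the activity is TWO live terms with ONE common integral, and the END's quantity is NOT zero -/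

open Classical in
/-- **THE ACTIVITY AT `X₀` IN CLOSED FORM**: `act k s X₀ = (cM r∕2)·(ε + v)·∫ e^{s·r·e^{−(v 0)²}}·e^{−‖v‖²} dv` (W41 `termAt_coreW_pencil`, ONE common
integral; `majN_sum_X₀`). [folklore] -/
theorem actN_X₀ (k : ℕ) (s : ℂ) :
    actN L N' r hr k s (X₀ N') = ((cM r / 2 * (εN L + vN) : ℝ) : ℂ) *
      ∫ v : E1, cexp (s * ((r : ℂ) * (Real.exp (-(crd v ^ 2)) : ℂ))) * cexp (-(((‖v‖ ^ 2 : ℝ) : ℂ))) := by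
  unfold actN
  simp only [GN_apply, termAt_coreW_pencil]
  rw [← Finset.sum_mul, ← majN_sum_X₀ L N', Finset.mul_sum]
  push_cast
  unfold cN
  push_cast
  rfl

/-- The increment between a REAL source `t` and `0` at `X₀`: `(cM r∕2)(ε + v)·∫ incr (t·r)` (W41 `closedForm_real_sub_zero`). [folklore] -/
theorem actN_real_sub_zero (k : ℕ) (t : ℝ) :
    actN L N' r hr k (t : ℂ) (X₀ N') - actN L N' r hr k 0 (X₀ N') =
      ((cM r / 2 * (εN L + vN) : ℝ) : ℂ) * ((∫ v, incr (t * r) v : ℝ) : ℂ) := by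
  rw [actN_X₀, actN_X₀]
  exact closedForm_real_sub_zero _ r hr t

/-- **THE ATTACHED PART OF THE ACTIVITY IS NOT ZERO** (`(cM r∕2)(ε + v) > 0`, W33's `∫ incr r > 0` for `0 < r`). [folklore] -/
theorem actN_live (hr0 : 0 < r) (k : ℕ) : actN L N' r hr k 1 (X₀ N') ≠ actN L N' r hr k 0 (X₀ N') := by
  intro h
  have h0 := sub_eq_zero.2 h
  rw [show (1 : ℂ) = ((1 : ℝ) : ℂ) from Complex.ofReal_one.symm, actN_real_sub_zero, one_mul] at h0
  have hc : 0 < cM r / 2 * (εN L + vN) := mul_pos (half_pos (cM_pos r)) (by linarith [εN_pos L, vN_pos])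
  rcases mul_eq_zero.1 h0 with hc0 | hI
  · exact hc.ne' (by exact_mod_cast hc0)
  · exact (integral_incr_pos r hr0).ne' (by exact_mod_cast hI)

/-- The activities at `X₀` lie STRICTLY inside the unit disc for `‖s‖ ≤ 2` (`ε + v ≤ 65∕64`, W41 `norm_term_le`, `A ≤ 1`, `√π∕√(2π) ≤ 1∕√2 < 64∕65·…`:
we use the crude chain `(65∕64)·(A∕2)·(√π∕√(2π)) < 1` from `A ≤ 1` and `√π∕√(2π) < 1`). [folklore] -/
theorem norm_actN_X₀_lt_one (k : ℕ) {s : ℂ} (hs : ‖s‖ ≤ 2) : ‖actN L N' r hr k s (X₀ N')‖ < 1 := by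
  rw [actN_X₀]
  have hp0 : 0 ≤ εN L + vN := by linarith [εN_pos L, vN_pos]
  have hp1 := εN_add_vN_le L
  have hπ : 0 < Real.sqrt Real.pi := Real.sqrt_pos.2 Real.pi_pos
  have hlt : Real.sqrt Real.pi < Real.sqrt (2 * Real.pi) := Real.sqrt_lt_sqrt Real.pi_pos.le (by linarith [Real.pi_pos])
  have hq : Real.sqrt Real.pi / Real.sqrt (2 * Real.pi) < 1 := (div_lt_one (hπ.trans hlt)).2 hlt
  have hq0 : 0 ≤ Real.sqrt Real.pi / Real.sqrt (2 * Real.pi) := by positivity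
  have hA : Acst ≤ 1 := dressedConst_le_one
  have hb := norm_term_le r hr hs
  have hn : ‖((cM r / 2 * (εN L + vN) : ℝ) : ℂ) * ∫ v : E1, cexp (s * ((r : ℂ) * (Real.exp (-(crd v ^ 2)) : ℂ))) *
        cexp (-(((‖v‖ ^ 2 : ℝ) : ℂ)))‖ =
      (εN L + vN) * ‖((cM r / 2 : ℝ) : ℂ) * ∫ v : E1, cexp (s * ((r : ℂ) * (Real.exp (-(crd v ^ 2)) : ℂ))) *
        cexp (-(((‖v‖ ^ 2 : ℝ) : ℂ)))‖ := by
    rw [norm_mul, norm_mul, Complex.norm_real, Complex.norm_real, Real.norm_eq_abs, Real.norm_eq_abs, abs_mul, abs_of_nonneg hp0]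
    ring
  rw [hn]
  calc (εN L + vN) * ‖((cM r / 2 : ℝ) : ℂ) * ∫ v : E1, cexp (s * ((r : ℂ) * (Real.exp (-(crd v ^ 2)) : ℂ))) *
          cexp (-(((‖v‖ ^ 2 : ℝ) : ℂ)))‖
      ≤ (1 + 1 / 64) * (Acst / 2 * (Real.sqrt Real.pi / Real.sqrt (2 * Real.pi))) := mul_le_mul hp1 hb (norm_nonneg _) (by norm_num)
    _ < 1 := by
        have := Acst_pos
        nlinarith

open Classical in
/-- **THE END's BOUNDED QUANTITY IS NOT ZERO** [decided toy]: equal dressed outputs on the coarse unit block would give equal activities at `X₀`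
(W24's `exp_locE_cube` at the COARSE torus BY NAME), contradicting `actN_live`. [folklore] -/
theorem nestedToriEnd_live (hr0 : 0 < r) (k : ℕ) :
    locE (TTouch (d := 4) (N := N')) (fun Z : (tsys 4 N').Dom => Z.1) (actN L N' r hr k 1) (X₀ N').1 ≠
      locE (TTouch (d := 4) (N := N')) (fun Z : (tsys 4 N').Dom => Z.1) (actN L N' r hr k 0) (X₀ N').1 := by
  intro h
  have h1 := exp_locE_cube N' (w := actN L N' r hr k 1) (norm_actN_X₀_lt_one L N' r hr k (by simp))
  have h0 := exp_locE_cube N' (w := actN L N' r hr k 0) (norm_actN_X₀_lt_one L N' r hr k (by simp))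
  have h' : cexp (locE (TTouch (d := 4) (N := N')) (fun Z : (tsys 4 N').Dom => Z.1) (actN L N' r hr k 1) {0}) =
      cexp (locE (TTouch (d := 4) (N := N')) (fun Z : (tsys 4 N').Dom => Z.1) (actN L N' r hr k 0) {0}) := congrArg cexp h
  rw [h1, h0, add_right_inj] at h'
  exact actN_live L N' r hr hr0 k h'

open Classical in
/-- **THE NESTED-TORI END FIRES ON A LIVE TWO-SCALE DATUM**, at pv22's least blocking factor `L = 3` (ℓ = 3∕7) AND at print's least admitted one
`L = 13` ([Balaban1987RGI] p.251 «L an odd positive integer > 11» — TYPE only; ℓ = 143∕37): bound ∧ liveness on every coarse torus `N′`. [folklore] -/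
example (hr0 : 0 < r) (k : ℕ) :
    (locE (TTouch (d := 4) (N := N')) (fun Z : (tsys 4 N').Dom => Z.1) (actN 3 N' r hr k 1) (X₀ N').1 ≠
        locE (TTouch (d := 4) (N := N')) (fun Z : (tsys 4 N').Dom => Z.1) (actN 3 N' r hr k 0) (X₀ N').1 ∧
      ‖locE (TTouch (d := 4) (N := N')) (fun Z : (tsys 4 N').Dom => Z.1) (actN 3 N' r hr k 1) (X₀ N').1 -
          locE (TTouch (d := 4) (N := N')) (fun Z : (tsys 4 N').Dom => Z.1) (actN 3 N' r hr k 0) (X₀ N').1‖ ≤ K₀ 64 8) ∧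
    (locE (TTouch (d := 4) (N := N')) (fun Z : (tsys 4 N').Dom => Z.1) (actN 13 N' r hr k 1) (X₀ N').1 ≠
        locE (TTouch (d := 4) (N := N')) (fun Z : (tsys 4 N').Dom => Z.1) (actN 13 N' r hr k 0) (X₀ N').1 ∧
      ‖locE (TTouch (d := 4) (N := N')) (fun Z : (tsys 4 N').Dom => Z.1) (actN 13 N' r hr k 1) (X₀ N').1 -
          locE (TTouch (d := 4) (N := N')) (fun Z : (tsys 4 N').Dom => Z.1) (actN 13 N' r hr k 0) (X₀ N').1‖ ≤ K₀ 64 8) :=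
  ⟨⟨nestedToriEnd_live 3 N' r hr hr0 k, nestedToriEnd_fires_closed 3 N' r hr (by norm_num) k⟩,
   ⟨nestedToriEnd_live 13 N' r hr hr0 k, nestedToriEnd_fires_closed 13 N' r hr (by norm_num) k⟩⟩

end Live

end Summit.QuantumFields.BalabanUV.T4Continuum.NE1p.DressedSmallFieldNestedToriWitness

end
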